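import Summits.CriticalPhenomena.Ising3DConformalLimit.Theorems.PerfectScreeningGaussianLimitIsCoulombReductions
import Summits.CriticalPhenomena.Ising3DConformalLimit.Theorems.PerfectScreeningGaussianLimitIsCoulombRenormalisation
import Summits.CriticalPhenomena.Ising3DConformalLimit.Theorems.PerfectScreeningEventuallySubharmonic
import Summits.CriticalPhenomena.Ising3DConformalLimit.Theorems.PerfectScreeningScreeningDichotomyEventual
import Summits.CriticalPhenomena.Ising3DConformalLimit.Theorems.GaussianLimitNotScreened.Negative.Reformulation
import HarnessLib

/-!
# `PerfectScreening.GaussianLimitIsCoulomb` (item stmt-CriticalPhenomena-1343): discharged reductions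

THEOREM-ONLY file (no definitions, no named facts), `--supports stmt-CriticalPhenomena-1343`,
third of the series after `…Reductions.lean` (p78360) and `…Renormalisation.lean` (p84140).

Since those two files landed, three support items of the route became THEOREMS of the tree:
`GreenAsymptotics` (1345, `Theorems.GreenAsymptotics_proof`), `ScreeningDichotomy` (1348,
`Theorems.PerfectScreening.screeningDichotomy_proof`) and `ScreeningDichotomyEventual` (13888,
`Theorems.PerfectScreening.screeningDichotomyEventual_proof`), and the analytic tail of SubH,
`EventuallySubharmonic` (13887), got its own toolbox (`Theorems.screeningUpgrade_of_eventuallySubharmonic`,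
`Theorems.eventuallySubharmonic_of_subharmonicOffOrigin`). Feeding them into the conditional
equivalences of `…Reductions.lean` leaves exactly ONE lattice hypothesis:

* `gaussianLimitIsCoulomb_iff_notScreened_of_eventuallySubharmonic` — under `EventuallySubharmonic`
  (13887) ALONE, the strong support item 1343 (`GaussianLimitIsCoulomb`, Coulomb lower bound) and
  the route's crux r4 13886 (`GaussianLimitNotScreened`, no perfect screening) are EQUIVALENT;
  `…_of_subharmonicOffOrigin` — the same under the crux r2 `SubharmonicOffOrigin` (1341);
* `gaussianLimitIsCoulomb_of_subharmonicOffOrigin_of_notScreened` — hence the item FOLLOWS from the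
  route's own cruxes r2 and r4 (no r3 `CoulombImpliesNontrivial`, no r5 `MoebiusLimitExists`):
  whenever the deciding theorem `Theses.PerfectScreening.closes` fires, item 1343 is settled too;
  `gaussianLimitIsCoulomb_of_eventuallySubharmonic_of_notScreened` — likewise from the pre-filed
  repair 13887 of r2 and r4;
* `nonSaturation_iff_screened_of_eventuallySubharmonic` — under 13887 the weak `η > 0` statement
  `NonSaturation` (1342, `liminf n·G(n e₁) = 0`) and perfect screening `‖x‖·G(x) → 0` coincide, so
  (`gaussianLimitIsCoulomb_iff_screened_imp_of_eventuallySubharmonic`) the item reads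
  "perfect screening forbids a non-degenerate Möbius-covariant Gaussian pointwise limit";
* `gaussianLimitIsCoulomb_of_nonGaussian_split` — the item from Möbius-restricted non-Gaussianity
  SPLIT along the dimension window `Δ ∈ [1/2, 3/4]` of the tree
  (`GaussianLimitNotScreenedNegative.dimension_window_and_eta`, Duminil-Copin–Panis `η ≤ 1/2`):
  "`U₄ ≢ 0` for `Δ < 3/4`" plus "`U₄ ≢ 0` at the marginal `Δ = 3/4`" — exactly the two inputs the
  lines of crux 13886 produce (their composition never uses the screening hypothesis), so the same
  two inputs settle item 1343.

Nothing here is new mathematics; the file records the closure map of the item against the CURRENT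
tree: 1343 ⇐ 0636 (`gaussianLimitIsCoulomb_of_r4NonGaussian`), 1343 ⇐ Möbius-restricted
non-Gaussianity (`gaussianLimitIsCoulomb_of_moebius_nonGaussian`), and now 1343 ⇔ 13886 given
13887 (or 1341). The item itself (a Gaussian Möbius limit of the nearest-neighbour model is
Coulomb-normalised) stays open: see the docstring of `Theses.PerfectScreening.GaussianLimitIsCoulomb`.

References: A. Messager, S. Miracle-Solé, J. Stat. Phys. 17 (1977) 245–262 (axial monotonicity);
G. F. Lawler, V. Limic, *Random Walk: A Modern Introduction* (2010), Thm. 4.3.1, §6.1–6.2.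
-/

noncomputable section

namespace Summit.CriticalPhenomena.Ising3DConformalLimit.PerfectScreeningGaussianLimitIsCoulomb

open Literature.Probability.LatticeModels Filter Set
open scoped Topology
open Summit.CriticalPhenomena.Ising3DConformalLimit.Theses
open Summit.CriticalPhenomena.Ising3DConformalLimit.Theorems

/-! ### §1 The item and the crux r4 are equivalent under `EventuallySubharmonic` alone -/

/-- **1343 ⇔ 13886 under the analytic tail of SubH.** If the critical two-point function of the
nearest-neighbour Ising model on `ℤ³` is lattice-subharmonic outside a finite ball
(`EventuallySubharmonic`, item 13887), then `GaussianLimitIsCoulomb` (item 1343: a non-degenerate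
Möbius-covariant Gaussian pointwise limit forces `c/‖x‖ ≤ G`) holds iff `GaussianLimitNotScreened`
(crux r4, item 13886: such a limit forbids `‖x‖·G(x) → 0`). The Green asymptotics (1345) and the
eventual screening dichotomy (13888) used by `gaussianLimitIsCoulomb_iff_notScreened_eventual` are
now the tree theorems `GreenAsymptotics_proof` and `screeningDichotomyEventual_proof`. [folklore] -/
theorem gaussianLimitIsCoulomb_iff_notScreened_of_eventuallySubharmonic
    (hEv : PerfectScreening.EventuallySubharmonic) :
    PerfectScreening.GaussianLimitIsCoulomb ↔ PerfectScreening.GaussianLimitNotScreened :=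
  gaussianLimitIsCoulomb_iff_notScreened_eventual GreenAsymptotics_proof hEv
    PerfectScreening.screeningDichotomyEventual_proof

/-- **1343 ⇔ 13886 under the crux r2.** If `SubharmonicOffOrigin` (item 1341) holds, then
`GaussianLimitIsCoulomb ↔ GaussianLimitNotScreened`; the antecedents `GreenAsymptotics` (1345) and
`ScreeningDichotomy` (1348) of `gaussianLimitIsCoulomb_iff_notScreened` are the tree theorems
`GreenAsymptotics_proof` and `screeningDichotomy_proof`. [folklore] -/
theorem gaussianLimitIsCoulomb_iff_notScreened_of_subharmonicOffOrigin
    (hSubH : PerfectScreening.SubharmonicOffOrigin) :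
    PerfectScreening.GaussianLimitIsCoulomb ↔ PerfectScreening.GaussianLimitNotScreened :=
  gaussianLimitIsCoulomb_iff_notScreened GreenAsymptotics_proof hSubH
    PerfectScreening.screeningDichotomy_proof

/-! ### §2 The item follows from the route's own cruxes r2 and r4 -/

/-- **13887 ∧ 13886 ⇒ 1343.** From the pre-filed repair `EventuallySubharmonic` of the crux r2 and
the crux r4 `GaussianLimitNotScreened`, the strong support item `GaussianLimitIsCoulomb` follows
(the screened branch of the eventual dichotomy is excluded by r4, the Coulomb branch is the
conclusion). [folklore] -/
theorem gaussianLimitIsCoulomb_of_eventuallySubharmonic_of_notScreened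
    (hEv : PerfectScreening.EventuallySubharmonic)
    (hGNS : PerfectScreening.GaussianLimitNotScreened) :
    PerfectScreening.GaussianLimitIsCoulomb :=
  (gaussianLimitIsCoulomb_iff_notScreened_of_eventuallySubharmonic hEv).2 hGNS

/-- **r2 ∧ r4 ⇒ 1343.** From the cruxes `SubharmonicOffOrigin` (r2, item 1341) and
`GaussianLimitNotScreened` (r4, item 13886) of route `PerfectScreening` the support item
`GaussianLimitIsCoulomb` (1343) follows — two of the four hypotheses of the deciding theorem
`Theses.PerfectScreening.closes` already settle it (`CoulombImpliesNontrivial` and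
`MoebiusLimitExists` are not used). [folklore] -/
theorem gaussianLimitIsCoulomb_of_subharmonicOffOrigin_of_notScreened
    (hSubH : PerfectScreening.SubharmonicOffOrigin)
    (hGNS : PerfectScreening.GaussianLimitNotScreened) :
    PerfectScreening.GaussianLimitIsCoulomb :=
  gaussianLimitIsCoulomb_of_eventuallySubharmonic_of_notScreened
    (eventuallySubharmonic_of_subharmonicOffOrigin hSubH) hGNS

/-! ### §3 Under `EventuallySubharmonic`, `NonSaturation` is perfect screening -/

/-- **`NonSaturation ↔ ‖x‖·G(x) → 0` under 13887.** If the critical two-point function is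
lattice-subharmonic outside a finite ball, then the liminf statement `NonSaturation` (item 1342,
`∀ ε > 0, ∃ᶠ n, n·⟨σ₀σ_{n e₁}⟩_{β_c} < ε`) is equivalent to perfect screening along the cofinite
filter of `ℤ³`: (⇒) is the exterior maximum principle `screeningUpgrade_of_eventuallySubharmonic`
fed with the tree theorem `GreenAsymptotics_proof`; (⇐) needs no subharmonicity — perfect screening
excludes a Coulomb lower bound (`not_tendsto_norm_mul_of_coulomb`), whose failure is `NonSaturation`
(`not_coulomb_iff_nonSaturation`, Messager–Miracle-Solé). [folklore] -/
theorem nonSaturation_iff_screened_of_eventuallySubharmonic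
    (hEv : PerfectScreening.EventuallySubharmonic) :
    PerfectScreening.NonSaturation ↔
      Tendsto (fun x : Site 3 => ‖x‖ * criticalTwoPoint 3 x) cofinite (𝓝 0) := by
  constructor
  · exact screeningUpgrade_of_eventuallySubharmonic GreenAsymptotics_proof hEv
  · intro hT
    refine not_coulomb_iff_nonSaturation.1 ?_
    rintro ⟨c, hc, hlow⟩
    exact not_tendsto_norm_mul_of_coulomb hc hlow hT

/-- **The item under 13887, screening form.** If `EventuallySubharmonic` holds, then
`GaussianLimitIsCoulomb` is equivalent to: perfect screening `‖x‖·⟨σ₀σ_x⟩_{β_c} → 0` implies that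
every non-degenerate Möbius-covariant pointwise scaling limit of `criticalCorr 3` has `U₄ ≢ 0`
(combine `gaussianLimitIsCoulomb_iff_nonSaturation_imp` with
`nonSaturation_iff_screened_of_eventuallySubharmonic`). [folklore] -/
theorem gaussianLimitIsCoulomb_iff_screened_imp_of_eventuallySubharmonic
    (hEv : PerfectScreening.EventuallySubharmonic) :
    PerfectScreening.GaussianLimitIsCoulomb ↔
      (Tendsto (fun x : Site 3 => ‖x‖ * criticalTwoPoint 3 x) cofinite (𝓝 0) →
        ∀ (ρ : ℝ → ℝ) (Δ : ℝ) (S : CorrFamily 3), (∀ δ ∈ Set.Ioc (0:ℝ) 1, 0 < ρ δ) →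
          HasPointwiseScalingLimit (criticalCorr 3) ρ S → IsNondegenerateTwoPoint S →
          IsMoebiusCovariant Δ S → HasNontrivialU4 S) := by
  rw [gaussianLimitIsCoulomb_iff_nonSaturation_imp,
    nonSaturation_iff_screened_of_eventuallySubharmonic hEv]

/-! ### §4 The item from the Δ-split Möbius-restricted non-Gaussianity -/

/-- **1343 from non-Gaussianity below and at `Δ = 3/4`.** Suppose (a) every non-degenerate
Möbius-covariant pointwise scaling limit of `criticalCorr 3` with dimension `Δ < 3/4` has `U₄ ≢ 0`,
and (b) the same at the marginal dimension `Δ = 3/4`. Then `GaussianLimitIsCoulomb` holds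
(vacuously): by the tree's dimension window (`dimension_window_and_eta`: `Δ ∈ [1/2, 3/4]` for
non-degenerate scale-covariant limits, Duminil-Copin–Panis 2025 Thm 1.5 inside) no other `Δ`
occurs, so (a)+(b) are Möbius-restricted non-Gaussianity and
`gaussianLimitIsCoulomb_of_moebius_nonGaussian` applies. (a) and (b) are exactly the two inputs of
the skeleton theorem `GaussianLimitNotScreened_of` of the crux-13886 line
`karamata-amplitude-blind-merging` (its `hasNontrivialU4_of_lt_threeQuarters`, stated for the larger
class of scale-covariant-on-`NonCoincident` limits, and its residual `stub_noMarginalGaussianLimit`,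
verbatim (b)). [folklore] -/
theorem gaussianLimitIsCoulomb_of_nonGaussian_split
    (hlt : ∀ (ρ : ℝ → ℝ) (Δ : ℝ) (S : CorrFamily 3), (∀ δ ∈ Set.Ioc (0:ℝ) 1, 0 < ρ δ) →
      HasPointwiseScalingLimit (criticalCorr 3) ρ S → IsNondegenerateTwoPoint S →
      IsMoebiusCovariant Δ S → Δ < 3 / 4 → HasNontrivialU4 S)
    (hmarg : ∀ (ρ : ℝ → ℝ) (S : CorrFamily 3), (∀ δ ∈ Set.Ioc (0:ℝ) 1, 0 < ρ δ) →
      HasPointwiseScalingLimit (criticalCorr 3) ρ S → IsNondegenerateTwoPoint S →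
      IsMoebiusCovariant (3 / 4) S → HasNontrivialU4 S) :
    PerfectScreening.GaussianLimitIsCoulomb := by
  refine gaussianLimitIsCoulomb_of_moebius_nonGaussian fun ρ Δ S hρ hlim hnd hM => ?_
  obtain ⟨hwin, -⟩ :=
    GaussianLimitNotScreenedNegative.dimension_window_and_eta hρ hlim hnd hM.isScaleCovariant
  by_cases hlt' : Δ < 3 / 4
  · exact hlt ρ Δ S hρ hlim hnd hM hlt'
  · have hΔ : Δ = 3 / 4 := le_antisymm hwin.2 (not_lt.1 hlt')
    subst hΔ
    exact hmarg ρ S hρ hlim hnd hM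

/-- **What (a) alone gives: the item restricted away from the marginal corner.** If every
non-degenerate Möbius-covariant pointwise limit with `Δ < 3/4` has `U₄ ≢ 0`, then the conclusion
of `GaussianLimitIsCoulomb` holds for every Gaussian Möbius limit EXCEPT possibly at `Δ = 3/4` —
stated as: the hypotheses of the item with `Δ ≠ 3/4` are contradictory. [folklore] -/
theorem gaussianLimitIsCoulomb_off_marginal_of_nonGaussian_lt
    (hlt : ∀ (ρ : ℝ → ℝ) (Δ : ℝ) (S : CorrFamily 3), (∀ δ ∈ Set.Ioc (0:ℝ) 1, 0 < ρ δ) →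
      HasPointwiseScalingLimit (criticalCorr 3) ρ S → IsNondegenerateTwoPoint S →
      IsMoebiusCovariant Δ S → Δ < 3 / 4 → HasNontrivialU4 S)
    {ρ : ℝ → ℝ} {Δ : ℝ} {S : CorrFamily 3} (hρ : ∀ δ ∈ Set.Ioc (0:ℝ) 1, 0 < ρ δ)
    (hlim : HasPointwiseScalingLimit (criticalCorr 3) ρ S) (hnd : IsNondegenerateTwoPoint S)
    (hM : IsMoebiusCovariant Δ S) (hU4 : ¬ HasNontrivialU4 S) (hΔ : Δ ≠ 3 / 4) :
    ∃ c : ℝ, 0 < c ∧ ∀ x : Site 3, x ≠ 0 → c / ‖x‖ ≤ criticalTwoPoint 3 x := by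
  obtain ⟨hwin, -⟩ :=
    GaussianLimitNotScreenedNegative.dimension_window_and_eta hρ hlim hnd hM.isScaleCovariant
  exact absurd (hlt ρ Δ S hρ hlim hnd hM (lt_of_le_of_ne hwin.2 hΔ)) hU4

end Summit.CriticalPhenomena.Ising3DConformalLimit.PerfectScreeningGaussianLimitIsCoulomb

end
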